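import Summits.QuantumFields.YangMills.Theorems.BalabanUVNodesN15KingModelTreeGraphDressed

/-!
# BalabanUVNodes ∕ N15 — THE KING-MODEL RUNG (PART Ι-f): THE TREE VALUE **IS** PART Η-a's FLAT GRAPH VALUE — `treeAmp w P u g T = graphValLS w src tgt …` for the flat
# shape of the tree `T` (vertices, lines, endpoints read off the left-child∕right-sibling encoding); so parts Η (the replacement step for arbitrary graph shapes)
# and Ι (the power counting for tree shapes) speak of the same `E(H)` of (3.55)–(3.56)
# (Track A, DAG node N15 = NE2; FAN-OUT v1.1 §N15 s3 «KING-MODEL RUNG … NE2's analogue DECIDED in the model»)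

HONEST FRAMING.  Count-neutral (cell `pub-ymgap`, seat `pub-ymgap-dag-n15-e` g26; `--supports stmt-QuantumFields-27366 --as helper` = K3⁸
`SpineGivenEndpointR13SepCoPHV`).  TEMPLATE LITERATURE: C. King, *The U(1) Higgs model. I. The continuum limit*, Commun. Math. Phys. **102** (1986) 649–677
[King1986], (3.55)–(3.56) p. 662 (the graph values `E(H)`), p. 664 (the vertex sums).  Part Ι-a's docstring READS `treeVal` as «the flat sum over all vertex
placements of part Η-a (`graphVal`), organised leaf-first»; this file makes that reading a THEOREM (generic bookkeeping over finite sorts — Fubini on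
`(V_t ⊕ V_r → S) ≃ (V_t → S) × (V_r → S)`).  MODEL-LEVEL GENERIC; NOT Bałaban's `G(U)`; NOT a node discharge; nothing continuum ∕ ℝ⁴ ∕ OS ∕ mass-gap ∕ Clay.
0 `sorry`; standard axioms.
WHAT THIS FILE PROVES (namespace `Summit.QuantumFields.YangMills.BalabanUVNodes.N15KingModelRung.Graph`).
* §1 THE FLAT SHAPE OF A TREE (structural recursion): `STree.Verts T` (`Unit` ∕ `Verts t ⊕ Verts r`), `STree.Lines T` (`PEmpty` ∕ `Unit ⊕ (Lines t ⊕ Lines r)`),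
  `root`, the endpoints `lsrc`∕`ltgt` (the new line of `line ℓ t r` runs from the root of `r` to the root of `t`), the labels `llab`∕`vlab`; their `Fintype` ∕
  `DecidableEq` structures `fintypeVerts`, `fintypeLines`, `decEqVerts` (reducible DEFINITIONS handed explicitly — no instances declared); `nverts_pos`,
  `card_verts` (`= nverts T`).
* §2 ★ `treeVal_eq_sum_pinned` — `treeVal w P u T y = Σ_{σ : Verts T → S, σ(root) = y} w^{nverts T − 1}·Π_λ P_{llab λ}(σ(lsrc λ), σ(ltgt λ))·Π_v u_{vlab v}(σ v)` (the
  root PINNED at `y`; induction on `T`, Fubini over `Verts t ⊕ Verts r`, the inner pinned sum collapsing the vertex sum of the new line);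
  ★★ **`treeAmp_eq_graphValLS`** — `treeAmp w P u g T = graphValLS w (lsrc T) (ltgt T) (P ∘ llab T) vtx u′` with the one-vertex sites `Option (Verts T)`: `none ↦`
  the root carrying the source `g`, `some v ↦ v` carrying `u_{vlab v}` — the amplitude of part Ι-a IS the graph value of part Η-a for the tree's flat shape.
HONEST SCOPE.  Bookkeeping only (no estimate); generic finite sorts over a commutative semiring∕`RCLike 𝕜` as in parts Η-a∕Ι-a.  Locators: [King1986] (3.55)–(3.56)
p.662, p.664–665 (vertex sums, re-pairing).
-/

noncomputable section

namespace Summit.QuantumFields.YangMills.BalabanUVNodes.N15KingModelRung.Graph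

open scoped BigOperators
open Finset

namespace STree

variable {ι υ : Type*}

/-! ## §1 The flat shape of a tree -/

/-- the flat vertex sort of a tree: one vertex for `vtx`, the disjoint union for `line`. [cite: King1986, (3.55) p.662] -/
@[reducible] def Verts : STree ι υ → Type
  | vtx _ => Unit
  | line _ t r => Verts t ⊕ Verts r

/-- the flat line sort: none for `vtx`; for `line ℓ t r` the new line plus those of `t` and `r`. [cite: King1986, (3.55) p.662] -/
@[reducible] def Lines : STree ι υ → Type
  | vtx _ => PEmpty
  | line _ t r => Unit ⊕ (Lines t ⊕ Lines r)

/-- the root vertex. [folklore] -/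
def root : (T : STree ι υ) → Verts T
  | vtx _ => ()
  | line _ _ r => Sum.inr (root r)

/-- the root-side endpoint of a line (the new line of `line ℓ t r` starts at the root of `r`). [folklore] -/
def lsrc : (T : STree ι υ) → Lines T → Verts T
  | vtx _ => fun e => nomatch e
  | line _ t r => fun e => match e with
    | Sum.inl _ => Sum.inr (root r)
    | Sum.inr (Sum.inl e') => Sum.inl (lsrc t e')
    | Sum.inr (Sum.inr e') => Sum.inr (lsrc r e')

/-- the leaf-side endpoint of a line (the new line of `line ℓ t r` ends at the root of `t`). [folklore] -/
def ltgt : (T : STree ι υ) → Lines T → Verts T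
  | vtx _ => fun e => nomatch e
  | line _ t r => fun e => match e with
    | Sum.inl _ => Sum.inl (root t)
    | Sum.inr (Sum.inl e') => Sum.inl (ltgt t e')
    | Sum.inr (Sum.inr e') => Sum.inr (ltgt r e')

/-- the line labels. [folklore] -/
def llab : (T : STree ι υ) → Lines T → ι
  | vtx _ => fun e => nomatch e
  | line ℓ t r => fun e => match e with
    | Sum.inl _ => ℓ
    | Sum.inr (Sum.inl e') => llab t e'
    | Sum.inr (Sum.inr e') => llab r e'

/-- the vertex labels (each vertex carries the one-vertex factor of its `vtx` node). [folklore] -/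
def vlab : (T : STree ι υ) → Verts T → υ
  | vtx υ₀ => fun _ => υ₀
  | line _ t r => fun v => match v with
    | Sum.inl v' => vlab t v'
    | Sum.inr v' => vlab r v'

/-- every tree has at least one vertex. [folklore] -/
theorem nverts_pos : ∀ T : STree ι υ, 0 < nverts T
  | vtx _ => Nat.one_pos
  | line _ t _ => Nat.add_pos_left (nverts_pos t) _

/-- the finite structure of the vertex sort (a definition, handed explicitly below). [folklore] -/
@[reducible] def fintypeVerts : (T : STree ι υ) → Fintype (Verts T)
  | vtx _ => inferInstanceAs (Fintype Unit)
  | line _ t r => @instFintypeSum _ _ (fintypeVerts t) (fintypeVerts r)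

/-- the finite structure of the line sort. [folklore] -/
@[reducible] def fintypeLines : (T : STree ι υ) → Fintype (Lines T)
  | vtx _ => inferInstanceAs (Fintype PEmpty)
  | line _ t r => @instFintypeSum _ _ (inferInstanceAs (Fintype Unit)) (@instFintypeSum _ _ (fintypeLines t) (fintypeLines r))

/-- decidable equality of the vertex sort. [folklore] -/
@[reducible] def decEqVerts : (T : STree ι υ) → DecidableEq (Verts T)
  | vtx _ => inferInstanceAs (DecidableEq Unit)
  | line _ t r => by letI := decEqVerts t; letI := decEqVerts r; exact inferInstanceAs (DecidableEq (Verts t ⊕ Verts r))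

/-- the vertex sort has `nverts T` elements. [folklore] -/
theorem card_verts : ∀ T : STree ι υ, @Fintype.card (Verts T) (fintypeVerts T) = nverts T
  | vtx _ => rfl
  | line _ t r => by
      rw [show @Fintype.card (Verts (line _ t r)) (fintypeVerts (line _ t r)) = @Fintype.card (Verts t ⊕ Verts r) (@instFintypeSum _ _ (fintypeVerts t) (fintypeVerts r)) from rfl,
        @Fintype.card_sum _ _ (fintypeVerts t) (fintypeVerts r), card_verts t, card_verts r]
      rfl

end STree

open STree

/-! ## §2 The tree value is the flat graph value -/

section Flat

variable {𝕜 : Type*} [RCLike 𝕜]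
variable {ι υ : Type*} {S : Type*} [Fintype S] [DecidableEq S]

/-- ★ **THE TREE VALUE WITH THE ROOT PINNED IS THE FLAT SUM OVER VERTEX PLACEMENTS**: for every tree `T` and root position `y`,
`treeVal w P u T y = Σ_{σ : Verts T → S, σ(root T) = y} w^{nverts T − 1}·(Π_λ P_{llab λ}(σ(lsrc λ), σ(ltgt λ)))·(Π_v u_{vlab v}(σ v))` — induction on `T`: Fubini
over `(Verts t ⊕ Verts r → S) ≃ (Verts t → S) × (Verts r → S)`, the products over `Lines (line ℓ t r) = Unit ⊕ (Lines t ⊕ Lines r)` split, and the pinned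
sum over `Verts t → S` is the vertex sum `Σ_{y′} w·P_ℓ(y, y′)·treeVal t y′` of the new line. [cite: King1986, (3.55)–(3.56) p.662, p.664] -/
theorem treeVal_eq_sum_pinned (w : 𝕜) (P : ι → S → S → 𝕜) (u : υ → S → 𝕜) :
    ∀ (T : STree ι υ) (y : S),
      treeVal w P u T y
        = haveI := fintypeVerts T; haveI := fintypeLines T; haveI := decEqVerts T
          ∑ σ : Verts T → S, if σ (root T) = y then
            w ^ (nverts T - 1) * ((∏ e : Lines T, P (llab T e) (σ (lsrc T e)) (σ (ltgt T e))) * ∏ v : Verts T, u (vlab T v) (σ v)) else 0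
  | vtx υ₀, y => by
      letI : Fintype (Verts (vtx υ₀ : STree ι υ)) := fintypeVerts _
      letI : Fintype (Lines (vtx υ₀ : STree ι υ)) := fintypeLines _
      letI : DecidableEq (Verts (vtx υ₀ : STree ι υ)) := decEqVerts _
      show u υ₀ y = ∑ σ : Unit → S, if σ () = y then w ^ (1 - 1) * ((∏ e : PEmpty, P (nomatch e) (σ (nomatch e)) (σ (nomatch e))) * ∏ v : Unit, u υ₀ (σ v)) else 0
      rw [← (Equiv.funUnique Unit S).symm.sum_comp]
      simp
  | line ℓ t r, y => by
      -- the two sub-shapes' structures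
      letI iVt : Fintype (Verts t) := fintypeVerts t
      letI iVr : Fintype (Verts r) := fintypeVerts r
      letI iLt : Fintype (Lines t) := fintypeLines t
      letI iLr : Fintype (Lines r) := fintypeLines r
      letI dVt : DecidableEq (Verts t) := decEqVerts t
      letI dVr : DecidableEq (Verts r) := decEqVerts r
      have IHt := treeVal_eq_sum_pinned w P u t
      have IHr := treeVal_eq_sum_pinned w P u r y
      -- the statement, unfolded to the sum over `Verts t ⊕ Verts r → S` (the flat structures of `line ℓ t r` ARE the sum structures)
      show treeVal w P u (line ℓ t r) y
        = ∑ σ : Verts t ⊕ Verts r → S, if σ (Sum.inr (root r)) = y then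
            w ^ (nverts t + nverts r - 1) *
              ((∏ e : Unit ⊕ (Lines t ⊕ Lines r), P (llab (line ℓ t r) e) (σ (lsrc (line ℓ t r) e)) (σ (ltgt (line ℓ t r) e)))
                * ∏ v : Verts t ⊕ Verts r, u (vlab (line ℓ t r) v) (σ v)) else 0
      rw [treeVal_line, IHr]
      -- Fubini: σ ↔ (σt, σr)
      rw [← (Equiv.sumArrowEquivProdArrow (Verts t) (Verts r) S).symm.sum_comp, Fintype.sum_prod_type, Finset.sum_comm]
      rw [Finset.mul_sum]
      refine Finset.sum_congr rfl fun σr _ => ?_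
      -- split on the pin
      by_cases hpin : σr (root r) = y
      · simp only [Equiv.sumArrowEquivProdArrow_symm_apply_inr, hpin, if_true]
        simp only [Fintype.prod_sum_type, Fintype.prod_unique, lsrc, ltgt, llab, vlab, Equiv.sumArrowEquivProdArrow_symm_apply_inl,
          Equiv.sumArrowEquivProdArrow_symm_apply_inr, hpin]
        -- the inner sum over `σt` is the vertex sum of the new line
        have hinner : ∑ y', w * P ℓ y y' * treeVal w P u t y'
            = ∑ σt : Verts t → S, w ^ nverts t * (P ℓ y (σt (root t)) *
                ((∏ e : Lines t, P (llab t e) (σt (lsrc t e)) (σt (ltgt t e))) * ∏ v : Verts t, u (vlab t v) (σt v))) := by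
          have h1 : ∀ y', treeVal w P u t y' = ∑ σt : Verts t → S, if σt (root t) = y' then
              w ^ (nverts t - 1) * ((∏ e : Lines t, P (llab t e) (σt (lsrc t e)) (σt (ltgt t e))) * ∏ v : Verts t, u (vlab t v) (σt v)) else 0 :=
            fun y' => IHt y'
          simp_rw [h1, Finset.mul_sum, Finset.sum_comm (s := (univ : Finset S))]
          refine Finset.sum_congr rfl fun σt _ => ?_
          simp_rw [mul_ite, mul_zero, Finset.sum_ite_eq, Finset.mem_univ, if_true]
          have hwt : w ^ nverts t = w ^ (nverts t - 1) * w := by rw [← pow_succ, Nat.sub_add_cancel (nverts_pos t)]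
          rw [hwt]; ring
        rw [hinner, Finset.sum_mul]
        refine Finset.sum_congr rfl fun σt _ => ?_
        have hntr : nverts t + nverts r - 1 = nverts t + (nverts r - 1) := by
          have := nverts_pos r; omega
        rw [hntr, pow_add]
        ring
      · simp only [Equiv.sumArrowEquivProdArrow_symm_apply_inr, hpin, if_false, mul_zero, Finset.sum_const_zero]

/-- ★★ **THE TREE AMPLITUDE IS PART Η-a's GRAPH VALUE OF THE FLAT SHAPE**: with the one-vertex sites `Option (Verts T)` (`none` = the root carrying the source
`g`, `some v` = the vertex `v` carrying `u_{vlab v}`), `treeAmp w P u g T = graphValLS w (lsrc T) (ltgt T) (P ∘ llab T) vtx u′`.  Hence parts Η (replacement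
step for arbitrary shapes) and Ι (power counting for tree shapes) are statements about the same `E(H)`. [cite: King1986, (3.55)–(3.56) p.662, p.664] -/
theorem treeAmp_eq_graphValLS (w : 𝕜) (P : ι → S → S → 𝕜) (u : υ → S → 𝕜) (g : S → 𝕜) (T : STree ι υ) :
    treeAmp w P u g T
      = haveI := fintypeVerts T; haveI := fintypeLines T; haveI := decEqVerts T
        graphValLS w (lsrc T) (ltgt T) (fun e => P (llab T e)) (fun o : Option (Verts T) => o.elim (root T) id)
          (fun o => match o with | none => g | some v => u (vlab T v)) := by
  letI := fintypeVerts T; letI := fintypeLines T; letI := decEqVerts T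
  unfold treeAmp graphValLS
  rw [card_verts]
  have h1 : ∀ x, treeVal w P u T x = ∑ σ : Verts T → S, if σ (root T) = x then
      w ^ (nverts T - 1) * ((∏ e : Lines T, P (llab T e) (σ (lsrc T e)) (σ (ltgt T e))) * ∏ v : Verts T, u (vlab T v) (σ v)) else 0 :=
    fun x => treeVal_eq_sum_pinned w P u T x
  simp_rw [h1, Finset.mul_sum, Finset.sum_comm (s := (univ : Finset S)), mul_ite, mul_zero, Finset.sum_ite_eq, Finset.mem_univ, if_true]
  refine Finset.sum_congr rfl fun σ _ => ?_
  rw [Fintype.prod_option]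
  simp only [Option.elim, id]
  have hw : w ^ nverts T = w ^ (nverts T - 1) * w := by rw [← pow_succ, Nat.sub_add_cancel (nverts_pos T)]
  rw [hw]
  ring

end Flat

end Summit.QuantumFields.YangMills.BalabanUVNodes.N15KingModelRung.Graph

end
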